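import Mathlib
import Literature.Geometry.DiscreteGeometry.KissingPatterns
import Summits.AtomisticToContinuum.Crystallization.Theorems.DisclinationRationFiveFoldRationStubPoleLemmaAux

/-!
# Crux `DisclinationRation.FiveFoldRation` (stmt-AtomisticToContinuum-15799), line `Sketch` —
# helpers for stub `stub_dr5_poleLemma` (pole lemma), part 2: the pole lemma in core form

Tolerance algebra for `1/20`-matchings, the transfer of five shell points to five pattern points,
and `dr5pl_core`: the pole lemma with the shell-symmetry facts (statement of stub
`stub_dr5_shellMutual`, specialised to `S`) as an explicit hypothesis.  The stub
`stub_dr5_poleLemma` itself is the three-line specialisation of `dr5pl_core`.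

Proof of `dr5pl_core`.  Let `e p = (0,0,s)`, `s = ±1`.  The five ring sites
`r_k := e⁻¹ (√3/2·cos(2πk/5), √3/2·sin(2πk/5), s/2)` of the hemisphere of `p` satisfy
`|r_k − p| ≤ 11/10·d_y` (the ring point is at distance `1` from its pole, plus two tolerances), and
shell symmetry gives `d_p ≥ 20/21·d_y`, `y ∈ T_p`, `|r_k − y| ≤ 21/20·d_y`; hence `r_k ∈ T_p` and, in
ANY `1/20`-matching of `T_p` (scale `d_p`), the images of the `r_k` are five distinct pattern points
other than the image of `y` at distance `≤ (21/20)² + 1/10 < 7/5` from it.  The valence facts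
(part 1) exclude fcc and hcp (so `¬ GF S p`, and the matching provided by `GA S p` is decahedral)
and force the image of `y` to be a pole; composing with the flip `diag(1,−1,−1)` if necessary makes
it the pole opposite to `e p`, with the same tolerance (`A₀ ∘ F ∘ F = A₀`).
Helper prefix `dr5pl_`.  Terms are written out (no local notations): `d_y = sInf ((fun w => dist w y) '' (S \ {y}))`,
`T_y = {x | x ∈ S ∧ x ≠ y ∧ dist x y < 13/10 · d_y}`, the ring point `r(k, σ) = WithLp.toLp 2 ![…, …, σ]`.
-/

noncomputable section

namespace Summit.AtomisticToContinuum.Crystallization.Theorems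

open Literature.Geometry.DiscreteGeometry

/-! ### Tolerance algebra -/

/-- Two shell points matched within `1/20` (after rescaling by `c`) to `A a`, `A a'`: the pattern
images are at distance `≤ c · dist u u' + 1/10`. -/
theorem dr5pl_img_dist_le {c : ℝ} (hc : 0 ≤ c) {u u' y a a' : (EuclideanSpace ℝ (Fin 3))} (A : (EuclideanSpace ℝ (Fin 3)) →ₗᵢ[ℝ] (EuclideanSpace ℝ (Fin 3)))
    (hu : dist (c • (u - y)) (A a) ≤ 1 / 20) (hu' : dist (c • (u' - y)) (A a') ≤ 1 / 20) :
    dist a a' ≤ c * dist u u' + 1 / 10 := by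
  have h1 : dist (c • (u - y)) (c • (u' - y)) = c * dist u u' := by
    rw [dist_smul₀, Real.norm_of_nonneg hc, dist_sub_right]
  have h2 : dist a a' = dist (A a) (A a') := (A.dist_map a a').symm
  have := dist_triangle4 (A a) (c • (u - y)) (c • (u' - y)) (A a')
  rw [dist_comm] at hu
  linarith

/-- Conversely the shell points are at distance `≤ c⁻¹ · (dist a a' + 1/10)`. -/
theorem dr5pl_dist_le_of_tol {c : ℝ} (hc : 0 < c) {u u' y a a' : (EuclideanSpace ℝ (Fin 3))} (A : (EuclideanSpace ℝ (Fin 3)) →ₗᵢ[ℝ] (EuclideanSpace ℝ (Fin 3)))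
    (hu : dist (c • (u - y)) (A a) ≤ 1 / 20) (hu' : dist (c • (u' - y)) (A a') ≤ 1 / 20) :
    dist u u' ≤ c⁻¹ * (dist a a' + 1 / 10) := by
  have h1 : dist (c • (u - y)) (c • (u' - y)) = c * dist u u' := by
    rw [dist_smul₀, Real.norm_of_nonneg hc.le, dist_sub_right]
  have h2 : dist a a' = dist (A a) (A a') := (A.dist_map a a').symm
  have := dist_triangle4 (c • (u - y)) (A a) (A a') (c • (u' - y))
  rw [dist_comm] at hu'
  rw [le_inv_mul_iff₀ hc]
  linarith

/-- **Transfer to the pattern.** Given a `1/20`-matching `(A'', e'')` of a shell `T` (scale `c`,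
centre `p₀`) with some pattern, a shell point `y₀` and five distinct shell points `R i ≠ y₀` with
`c · dist (R i) y₀ + 1/10 < 7/5`, the pattern images of the `R i` are five distinct pattern points
other than the image of `y₀`, all at distance `< 7/5` from it. -/
theorem dr5pl_images {P : (EuclideanSpace ℝ (Fin 3)) → Prop} {T : Set (EuclideanSpace ℝ (Fin 3))} (e'' : ↥T ≃ {x // P x}) (A'' : (EuclideanSpace ℝ (Fin 3)) →ₗᵢ[ℝ] (EuclideanSpace ℝ (Fin 3)))
    {c : ℝ} (hc : 0 ≤ c) (p₀ : (EuclideanSpace ℝ (Fin 3)))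
    (htol : ∀ t : ↥T, dist (c • ((t : (EuclideanSpace ℝ (Fin 3))) - p₀)) (A'' ((e'' t : {x // P x}) : (EuclideanSpace ℝ (Fin 3)))) ≤ 1 / 20)
    (y₀ : ↥T) (R : Fin 5 → ↥T) (hR : Function.Injective R) (hRy : ∀ i, (R i : (EuclideanSpace ℝ (Fin 3))) ≠ y₀)
    (hclose : ∀ i, c * dist (R i : (EuclideanSpace ℝ (Fin 3))) y₀ + 1 / 10 < 7 / 5) :
    Function.Injective (fun i => ((e'' (R i) : {x // P x}) : (EuclideanSpace ℝ (Fin 3)))) ∧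
      (∀ i, P ((e'' (R i) : {x // P x}) : (EuclideanSpace ℝ (Fin 3)))) ∧
      (∀ i, ((e'' (R i) : {x // P x}) : (EuclideanSpace ℝ (Fin 3))) ≠ ((e'' y₀ : {x // P x}) : (EuclideanSpace ℝ (Fin 3)))) ∧
      ∀ i, dist ((e'' (R i) : {x // P x}) : (EuclideanSpace ℝ (Fin 3))) ((e'' y₀ : {x // P x}) : (EuclideanSpace ℝ (Fin 3))) < 7 / 5 := by
  refine ⟨?_, fun i => (e'' (R i)).2, ?_, ?_⟩
  · intro i j hij
    exact hR (e''.injective (Subtype.ext hij))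
  · intro i h
    exact hRy i (congrArg Subtype.val (e''.injective (Subtype.ext h)))
  · intro i
    exact lt_of_le_of_lt (dr5pl_img_dist_le hc A'' (htol (R i)) (htol y₀)) (hclose i)

/-- A ring point is not on the axis at a different height. -/
theorem dr5pl_ring_ne_axis (k : Fin 5) {σ s : ℝ} (h : σ ≠ s) :
    (WithLp.toLp 2 (V := ∀ _ : Fin 3, ℝ) ![Real.sqrt 3 / 2 * Real.cos (2 * Real.pi * ((k : Fin 5) : ℝ) / 5), Real.sqrt 3 / 2 * Real.sin (2 * Real.pi * ((k : Fin 5) : ℝ) / 5), σ] : EuclideanSpace ℝ (Fin 3)) ≠ (!₂[(0 : ℝ), 0, s] : (EuclideanSpace ℝ (Fin 3))) := by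
  intro h'
  have := congrArg (fun v : (EuclideanSpace ℝ (Fin 3)) => v 2) h'
  simp at this
  exact h this

/-! ### The pole lemma (core) -/

/-- **Pole lemma, core form** (registered helper stub, one-line signature). For `S` separated and
everywhere alphabet-good, with the shell-symmetry conclusions at hand (hypothesis `hSM`, the
statement of stub `stub_dr5_shellMutual` specialised to `S`, capture-free form): if `(A, e)` is a
decahedral matching of the shell of `y ∈ S` and the shell site `p` is matched to a pole, then `p`
is not `{fcc, hcp}`-good, and some decahedral matching of the shell of `p` contains `y` and sends
it to the pole opposite to `e p`. -/
theorem dr5pl_core : ∀ D : Set (EuclideanSpace ℝ (Fin 3)), D = {p : EuclideanSpace ℝ (Fin 3) | p = !₂[(0 : ℝ), 0, 1] ∨ p = !₂[(0 : ℝ), 0, -1] ∨ ∃ k : Fin 5, ∃ σ : ℝ, (σ = 1 / 2 ∨ σ = -(1 / 2)) ∧ p = !₂[Real.sqrt 3 / 2 * Real.cos (2 * Real.pi * (k : ℝ) / 5), Real.sqrt 3 / 2 * Real.sin (2 * Real.pi * (k : ℝ) / 5), σ]} → ∀ S : Set (EuclideanSpace ℝ (Fin 3)), ∀ δ : ℝ,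 0 < δ → (∀ y ∈ S, ∀ z ∈ S, y ≠ z → δ ≤ dist y z) → (∀ y ∈ S, (let d : ℝ := sInf ((fun z => dist z y) '' (S \ {y})); let T : Set (EuclideanSpace ℝ (Fin 3)) := {z : EuclideanSpace ℝ (Fin 3) | z ∈ S ∧ z ≠ y ∧ dist z y < 13 / 10 * d}; ∃ A : EuclideanSpace ℝ (Fin 3) →ₗᵢ[ℝ] EuclideanSpace ℝ (Fin 3), (∃ e : ↥T ≃ ↥Literature.Geometry.DiscreteGeometry.fccKissingPattern, ∀ t : ↥T, dist (d⁻¹ • ((t : EuclideanSpace ℝ (Fin 3)) - y)) (A ((e t : ↥Literature.Geometry.DiscreteGeometry.fccKissingPattern) : EuclideanSpace ℝ (Fin 3))) ≤ 1 / 20) ∨ (∃ e : ↥T ≃ ↥Literature.Geometry.DiscreteGeometry.hcpKissingPattern, ∀ t : ↥T, dist (d⁻¹ • ((t : EuclideanSpace ℝ (Fin 3)) - y)) (A ((e t : ↥Literature.Geometry.DiscreteGeometry.hcpKissingPattern) : EuclideanSpace ℝ (Fin 3))) ≤ 1 / 20) ∨ (∃ e : ↥T ≃ ↥D, ∀ t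 : ↥T, dist (d⁻¹ • ((t : EuclideanSpace ℝ (Fin 3)) - y)) (A ((e t : ↥D) : EuclideanSpace ℝ (Fin 3))) ≤ 1 / 20))) → (∀ y ∈ S, ∀ z ∈ S, z ≠ y → dist z y < 13 / 10 * sInf ((fun z => dist z y) '' (S \ {y})) → sInf ((fun z => dist z y) '' (S \ {y})) ≤ dist z y ∧ dist z y ≤ 21 / 20 * sInf ((fun z => dist z y) '' (S \ {y})) ∧ dist y z < 13 / 10 * sInf ((fun w => dist w z) '' (S \ {z})) ∧ dist y z ≤ 21 / 20 * sInf ((fun w => dist w z) '' (S \ {z}))) → ∀ y ∈ S, ∀ A : EuclideanSpace ℝ (Fin 3) →ₗᵢ[ℝ] EuclideanSpace ℝ (Fin 3), ∀ e : ↥{z : EuclideanSpace ℝ (Fin 3) | z ∈ S ∧ z ≠ y ∧ dist z y < 13 / 10 * sInf ((fun z => dist z y) '' (S \ {y}))} ≃ ↥D, (∀ t : ↥{z : EuclideanSpace ℝ (Fin 3) | z ∈ S ∧ z ≠ y ∧ dist z y < 13 / 10 * sInf ((fun z => dist z y) '' (S \ {y}))}, dist ((sInf ((fun z => dist z y) ''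 (S \ {y})))⁻¹ • ((t : EuclideanSpace ℝ (Fin 3)) - y)) (A ((e t : ↥D) : EuclideanSpace ℝ (Fin 3))) ≤ 1 / 20) → ∀ p : ↥{z : EuclideanSpace ℝ (Fin 3) | z ∈ S ∧ z ≠ y ∧ dist z y < 13 / 10 * sInf ((fun z => dist z y) '' (S \ {y}))}, ∀ q : EuclideanSpace ℝ (Fin 3), (p : EuclideanSpace ℝ (Fin 3)) = q → (((e p : ↥D) : EuclideanSpace ℝ (Fin 3)) = !₂[(0 : ℝ), 0, 1] ∨ ((e p : ↥D) : EuclideanSpace ℝ (Fin 3)) = !₂[(0 : ℝ), 0, -1]) → (¬ (let d : ℝ := sInf ((fun z => dist z q) '' (S \ {q})); let T : Set (EuclideanSpace ℝ (Fin 3)) := {z : EuclideanSpace ℝ (Fin 3) | z ∈ S ∧ z ≠ q ∧ dist z q < 13 / 10 * d}; ∃ A : EuclideanSpace ℝ (Fin 3) →ₗᵢ[ℝ] EuclideanSpace ℝ (Fin 3), (∃ e : ↥T ≃ ↥Literature.Geometry.DiscreteGeometry.fccKissingPattern, ∀ t : ↥T, dist (d⁻¹ • ((t : EuclideanSpace ℝ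 (Fin 3)) - q)) (A ((e t : ↥Literature.Geometry.DiscreteGeometry.fccKissingPattern) : EuclideanSpace ℝ (Fin 3))) ≤ 1 / 20) ∨ (∃ e : ↥T ≃ ↥Literature.Geometry.DiscreteGeometry.hcpKissingPattern, ∀ t : ↥T, dist (d⁻¹ • ((t : EuclideanSpace ℝ (Fin 3)) - q)) (A ((e t : ↥Literature.Geometry.DiscreteGeometry.hcpKissingPattern) : EuclideanSpace ℝ (Fin 3))) ≤ 1 / 20))) ∧ ∃ A' : EuclideanSpace ℝ (Fin 3) →ₗᵢ[ℝ] EuclideanSpace ℝ (Fin 3), ∃ e' : ↥{z : EuclideanSpace ℝ (Fin 3) | z ∈ S ∧ z ≠ q ∧ dist z q < 13 / 10 * sInf ((fun z => dist z q) '' (S \ {q}))} ≃ ↥D, (∀ t : ↥{z : EuclideanSpace ℝ (Fin 3) | z ∈ S ∧ z ≠ q ∧ dist z q < 13 / 10 * sInf ((fun z => dist z q) '' (S \ {q}))}, dist ((sInf ((fun z => dist z q) '' (S \ {q})))⁻¹ • ((t : EuclideanSpace ℝ (Fin 3)) - q)) (A' ((e' t : ↥D) : EuclideanSpace ℝ (Fin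 3))) ≤ 1 / 20) ∧ ∃ hy : y ∈ {z : EuclideanSpace ℝ (Fin 3) | z ∈ S ∧ z ≠ q ∧ dist z q < 13 / 10 * sInf ((fun z => dist z q) '' (S \ {q}))}, ((e' ⟨y, hy⟩ : ↥D) : EuclideanSpace ℝ (Fin 3)) = -((e p : ↥D) : EuclideanSpace ℝ (Fin 3)) := by
  intro D hD S δ hδ hsep hgood hSM y hy A e he p q hq hp
  subst hD
  subst hq
  -- the shell site `p`
  have hpS : (p : (EuclideanSpace ℝ (Fin 3))) ∈ S := p.2.1
  have hpy : (p : (EuclideanSpace ℝ (Fin 3))) ≠ y := p.2.2.1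
  have hpd : dist (p : (EuclideanSpace ℝ (Fin 3))) y < 13 / 10 * sInf ((fun w => dist w y) '' (S \ {y})) := p.2.2.2
  -- scales
  have hinf : ∀ y' z : (EuclideanSpace ℝ (Fin 3)), z ∈ S → z ≠ y' → sInf ((fun w => dist w y') '' (S \ {y'})) ≤ dist z y' := fun y' z hz hne =>
    csInf_le ⟨0, by rintro _ ⟨w, -, rfl⟩; exact dist_nonneg⟩ ⟨z, ⟨hz, hne⟩, rfl⟩
  have hδy : δ ≤ sInf ((fun w => dist w y) '' (S \ {y})) := by
    refine le_csInf ⟨_, ⟨(p : (EuclideanSpace ℝ (Fin 3))), ⟨hpS, hpy⟩, rfl⟩⟩ ?_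
    rintro _ ⟨z, ⟨hzS, hzy⟩, rfl⟩
    show δ ≤ dist z y
    rw [dist_comm]
    exact hsep y hy z hzS (fun h => hzy h.symm)
  have hdy : 0 < sInf ((fun w => dist w y) '' (S \ {y})) := lt_of_lt_of_le hδ hδy
  obtain ⟨hSM1, hSM2, hSM3, hSM4⟩ := hSM y hy (p : (EuclideanSpace ℝ (Fin 3))) hpS hpy hpd
  have hyT : y ∈ {x : EuclideanSpace ℝ (Fin 3) | x ∈ S ∧ x ≠ (p : (EuclideanSpace ℝ (Fin 3))) ∧ dist x (p : (EuclideanSpace ℝ (Fin 3))) < 13 / 10 * sInf ((fun w => dist w (p : (EuclideanSpace ℝ (Fin 3)))) '' (S \ {(p : (EuclideanSpace ℝ (Fin 3)))}))} := ⟨hy, hpy.symm, hSM3⟩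
  have hdp_ge : 20 / 21 * sInf ((fun w => dist w y) '' (S \ {y})) ≤ sInf ((fun w => dist w (p : (EuclideanSpace ℝ (Fin 3)))) '' (S \ {(p : (EuclideanSpace ℝ (Fin 3)))})) := by
    rw [dist_comm] at hSM4; linarith
  have hdp : 0 < sInf ((fun w => dist w (p : (EuclideanSpace ℝ (Fin 3)))) '' (S \ {(p : (EuclideanSpace ℝ (Fin 3)))})) := by linarith
  -- the pole `(0, 0, s)`, `s = ±1`, to which `p` is matched
  obtain ⟨s, hs, hps⟩ : ∃ s : ℝ, (s = 1 ∨ s = -1) ∧ ((e p : ↥({p : EuclideanSpace ℝ (Fin 3) | p = !₂[(0 : ℝ), 0, 1] ∨ p = !₂[(0 : ℝ), 0, -1] ∨ ∃ k : Fin 5, ∃ σ : ℝ, (σ = 1 / 2 ∨ σ = -(1 / 2)) ∧ p = !₂[Real.sqrt 3 / 2 * Real.cos (2 * Real.pi * (k : ℝ) / 5), Real.sqrt 3 / 2 * Real.sin (2 * Real.pi * (k : ℝ) / 5), σ]} : Set (EuclideanSpace ℝ (Fin 3)))) : (EuclideanSpace ℝ (Fin 3))) = !₂[(0 : ℝ),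 0, s] := by
    rcases hp with h | h
    · exact ⟨1, Or.inl rfl, h⟩
    · exact ⟨-1, Or.inr rfl, h⟩
  have hs2 : s / 2 = 1 / 2 ∨ s / 2 = -(1 / 2) := by rcases hs with rfl | rfl <;> norm_num
  have hρ : ∀ k : Fin 5, (WithLp.toLp 2 (V := ∀ _ : Fin 3, ℝ) ![Real.sqrt 3 / 2 * Real.cos (2 * Real.pi * ((k : Fin 5) : ℝ) / 5), Real.sqrt 3 / 2 * Real.sin (2 * Real.pi * ((k : Fin 5) : ℝ) / 5), s / 2] : EuclideanSpace ℝ (Fin 3)) ∈ ({p : EuclideanSpace ℝ (Fin 3) | p = !₂[(0 : ℝ), 0, 1] ∨ p = !₂[(0 : ℝ), 0, -1] ∨ ∃ k : Fin 5, ∃ σ : ℝ, (σ = 1 / 2 ∨ σ = -(1 / 2)) ∧ p = !₂[Real.sqrt 3 / 2 * Real.cos (2 * Real.pi * (k : ℝ) / 5), Real.sqrt 3 / 2 * Real.sin (2 * Real.pi * (k : ℝ) / 5), σ]} : Set (EuclideanSpace ℝ (Fin 3))) := fun k => Or.inr (Or.inr ⟨k, s / 2, hs2, rfl⟩)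
  -- the five ring sites of the hemisphere of `p`
  obtain ⟨r, hr⟩ : ∃ r : Fin 5 → ↥{x : EuclideanSpace ℝ (Fin 3) | x ∈ S ∧ x ≠ y ∧ dist x y < 13 / 10 * sInf ((fun w => dist w y) '' (S \ {y}))}, ∀ k, ((e (r k) : ↥({p : EuclideanSpace ℝ (Fin 3) | p = !₂[(0 : ℝ), 0, 1] ∨ p = !₂[(0 : ℝ), 0, -1] ∨ ∃ k : Fin 5, ∃ σ : ℝ, (σ = 1 / 2 ∨ σ = -(1 / 2)) ∧ p = !₂[Real.sqrt 3 / 2 * Real.cos (2 * Real.pi * (k : ℝ) / 5), Real.sqrt 3 / 2 * Real.sin (2 * Real.pi * (k : ℝ) / 5), σ]} : Set (EuclideanSpace ℝ (Fin 3)))) : (EuclideanSpace ℝ (Fin 3))) = (WithLp.toLp 2 (V := ∀ _ : Fin 3, ℝ) ![Real.sqrt 3 / 2 * Real.cos (2 * Real.pi * ((k : Fin 5) : ℝ) / 5), Real.sqrt 3 / 2 * Real.sin (2 * Real.pi * ((k : Fin 5) : ℝ) / 5), s / 2] : EuclideanSpace ℝ (Fin 3)) :=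
    ⟨fun k => e.symm ⟨(WithLp.toLp 2 (V := ∀ _ : Fin 3, ℝ) ![Real.sqrt 3 / 2 * Real.cos (2 * Real.pi * ((k : Fin 5) : ℝ) / 5), Real.sqrt 3 / 2 * Real.sin (2 * Real.pi * ((k : Fin 5) : ℝ) / 5), s / 2] : EuclideanSpace ℝ (Fin 3)), hρ k⟩, fun k => by simp⟩
  have hrS : ∀ k, (r k : (EuclideanSpace ℝ (Fin 3))) ∈ S := fun k => (r k).2.1
  have hry : ∀ k, (r k : (EuclideanSpace ℝ (Fin 3))) ≠ y := fun k => (r k).2.2.1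
  have hrd : ∀ k, dist (r k : (EuclideanSpace ℝ (Fin 3))) y < 13 / 10 * sInf ((fun w => dist w y) '' (S \ {y})) := fun k => (r k).2.2.2
  have hry_le : ∀ k, dist (r k : (EuclideanSpace ℝ (Fin 3))) y ≤ 21 / 20 * sInf ((fun w => dist w y) '' (S \ {y})) := fun k =>
    (hSM y hy (r k) (hrS k) (hry k) (hrd k)).2.1
  have hrp_le : ∀ k, dist (r k : (EuclideanSpace ℝ (Fin 3))) (p : (EuclideanSpace ℝ (Fin 3))) ≤ 11 / 10 * sInf ((fun w => dist w y) '' (S \ {y})) := by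
    intro k
    have h1 := he (r k)
    have h2 := he p
    rw [hr k] at h1
    rw [hps] at h2
    have := dr5pl_dist_le_of_tol (inv_pos.2 hdy) A h1 h2
    rw [inv_inv, dr5pl_ring_pole_dist k s hs] at this
    linarith
  -- they lie in the shell of `p`
  have hrT : ∀ k, (r k : (EuclideanSpace ℝ (Fin 3))) ∈ {x : EuclideanSpace ℝ (Fin 3) | x ∈ S ∧ x ≠ (p : (EuclideanSpace ℝ (Fin 3))) ∧ dist x (p : (EuclideanSpace ℝ (Fin 3))) < 13 / 10 * sInf ((fun w => dist w (p : (EuclideanSpace ℝ (Fin 3)))) '' (S \ {(p : (EuclideanSpace ℝ (Fin 3)))}))} := by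
    intro k
    refine ⟨hrS k, ?_, ?_⟩
    · intro h
      have h' : r k = p := Subtype.ext h
      have := hr k
      rw [h', hps] at this
      exact dr5pl_ring_ne_axis k (by rcases hs with rfl | rfl <;> norm_num) this.symm
    · have := hrp_le k
      linarith
  obtain ⟨R, hR⟩ : ∃ R : Fin 5 → ↥{x : EuclideanSpace ℝ (Fin 3) | x ∈ S ∧ x ≠ (p : (EuclideanSpace ℝ (Fin 3))) ∧ dist x (p : (EuclideanSpace ℝ (Fin 3))) < 13 / 10 * sInf ((fun w => dist w (p : (EuclideanSpace ℝ (Fin 3)))) '' (S \ {(p : (EuclideanSpace ℝ (Fin 3)))}))}, ∀ k, (R k : (EuclideanSpace ℝ (Fin 3))) = r k :=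
    ⟨fun k => ⟨r k, hrT k⟩, fun k => rfl⟩
  have hRinj : Function.Injective R := by
    intro j k hjk
    have h1 : (r j : (EuclideanSpace ℝ (Fin 3))) = r k := by rw [← hR j, ← hR k, hjk]
    have h2 : r j = r k := Subtype.ext h1
    have h3 := hr j
    rw [h2, hr k] at h3
    exact (dr5pl_ring_inj h3).1.symm
  have hRy : ∀ k, (R k : (EuclideanSpace ℝ (Fin 3))) ≠ y := fun k => by rw [hR k]; exact hry k
  have hclose : ∀ k, (sInf ((fun w => dist w (p : (EuclideanSpace ℝ (Fin 3)))) '' (S \ {(p : (EuclideanSpace ℝ (Fin 3)))})))⁻¹ * dist (R k : (EuclideanSpace ℝ (Fin 3))) y + 1 / 10 < 7 / 5 := by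
    intro k
    rw [hR k]
    have h1 := hry_le k
    have h2 : dist (r k : (EuclideanSpace ℝ (Fin 3))) y ≤ sInf ((fun w => dist w (p : (EuclideanSpace ℝ (Fin 3)))) '' (S \ {(p : (EuclideanSpace ℝ (Fin 3)))})) * (441 / 400) := by linarith
    have h3 : (sInf ((fun w => dist w (p : (EuclideanSpace ℝ (Fin 3)))) '' (S \ {(p : (EuclideanSpace ℝ (Fin 3)))})))⁻¹ * dist (r k : (EuclideanSpace ℝ (Fin 3))) y ≤ 441 / 400 := by
      rw [inv_mul_le_iff₀ hdp]; exact h2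
    linarith
  -- no {fcc, hcp} matching of the shell of `p`
  have hnoF : ∀ (A'' : (EuclideanSpace ℝ (Fin 3)) →ₗᵢ[ℝ] (EuclideanSpace ℝ (Fin 3))) (e'' : ↥{x : EuclideanSpace ℝ (Fin 3) | x ∈ S ∧ x ≠ (p : (EuclideanSpace ℝ (Fin 3))) ∧ dist x (p : (EuclideanSpace ℝ (Fin 3))) < 13 / 10 * sInf ((fun w => dist w (p : (EuclideanSpace ℝ (Fin 3)))) '' (S \ {(p : (EuclideanSpace ℝ (Fin 3)))}))} ≃ ↥fccKissingPattern),
      (∀ t : ↥{x : EuclideanSpace ℝ (Fin 3) | x ∈ S ∧ x ≠ (p : (EuclideanSpace ℝ (Fin 3))) ∧ dist x (p : (EuclideanSpace ℝ (Fin 3))) < 13 / 10 * sInf ((fun w => dist w (p : (EuclideanSpace ℝ (Fin 3)))) '' (S \ {(p : (EuclideanSpace ℝ (Fin 3)))}))}, dist ((sInf ((fun w => dist w (p : (EuclideanSpace ℝ (Fin 3)))) '' (S \ {(p : (EuclideanSpace ℝ (Fin 3)))})))⁻¹ • ((t : (EuclideanSpace ℝ (Fin 3))) - (p : (EuclideanSpace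 ℝ (Fin 3)))))
        (A'' ((e'' t : ↥fccKissingPattern) : (EuclideanSpace ℝ (Fin 3)))) ≤ 1 / 20) → False := by
    intro A'' e'' he''
    obtain ⟨hinj, hmem, hneq, hdist⟩ :=
      dr5pl_images e'' A'' (inv_pos.2 hdp).le (p : (EuclideanSpace ℝ (Fin 3))) he'' ⟨y, hyT⟩ R hRinj hRy hclose
    obtain ⟨i, hi⟩ := dr5pl_fcc_valence (e'' ⟨y, hyT⟩).2 hinj hmem hneq
    exact absurd (hdist i) (not_lt.2 hi)
  have hnoH : ∀ (A'' : (EuclideanSpace ℝ (Fin 3)) →ₗᵢ[ℝ] (EuclideanSpace ℝ (Fin 3))) (e'' : ↥{x : EuclideanSpace ℝ (Fin 3) | x ∈ S ∧ x ≠ (p : (EuclideanSpace ℝ (Fin 3))) ∧ dist x (p : (EuclideanSpace ℝ (Fin 3))) < 13 / 10 * sInf ((fun w => dist w (p : (EuclideanSpace ℝ (Fin 3)))) '' (S \ {(p : (EuclideanSpace ℝ (Fin 3)))}))} ≃ ↥hcpKissingPattern),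
      (∀ t : ↥{x : EuclideanSpace ℝ (Fin 3) | x ∈ S ∧ x ≠ (p : (EuclideanSpace ℝ (Fin 3))) ∧ dist x (p : (EuclideanSpace ℝ (Fin 3))) < 13 / 10 * sInf ((fun w => dist w (p : (EuclideanSpace ℝ (Fin 3)))) '' (S \ {(p : (EuclideanSpace ℝ (Fin 3)))}))}, dist ((sInf ((fun w => dist w (p : (EuclideanSpace ℝ (Fin 3)))) '' (S \ {(p : (EuclideanSpace ℝ (Fin 3)))})))⁻¹ • ((t : (EuclideanSpace ℝ (Fin 3))) - (p : (EuclideanSpace ℝ (Fin 3)))))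
        (A'' ((e'' t : ↥hcpKissingPattern) : (EuclideanSpace ℝ (Fin 3)))) ≤ 1 / 20) → False := by
    intro A'' e'' he''
    obtain ⟨hinj, hmem, hneq, hdist⟩ :=
      dr5pl_images e'' A'' (inv_pos.2 hdp).le (p : (EuclideanSpace ℝ (Fin 3))) he'' ⟨y, hyT⟩ R hRinj hRy hclose
    obtain ⟨i, hi⟩ := dr5pl_hcp_valence (e'' ⟨y, hyT⟩).2 hinj hmem hneq
    exact absurd (hdist i) (not_lt.2 hi)
  refine ⟨?_, ?_⟩
  · rintro ⟨A'', ⟨e'', he''⟩ | ⟨e'', he''⟩⟩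
    · exact hnoF A'' e'' he''
    · exact hnoH A'' e'' he''
  · obtain ⟨A₀, hA₀⟩ := hgood (p : (EuclideanSpace ℝ (Fin 3))) hpS
    rcases hA₀ with ⟨e₀, he₀⟩ | ⟨e₀, he₀⟩ | ⟨e₀, he₀⟩
    · exact (hnoF A₀ e₀ he₀).elim
    · exact (hnoH A₀ e₀ he₀).elim
    · obtain ⟨hinj, hmem, hneq, hdist⟩ :=
        dr5pl_images e₀ A₀ (inv_pos.2 hdp).le (p : (EuclideanSpace ℝ (Fin 3))) he₀ ⟨y, hyT⟩ R hRinj hRy hclose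
      have hpole := dr5pl_deca_valence (e₀ ⟨y, hyT⟩).2 hinj hmem hneq hdist
      obtain ⟨F, hFF, hF⟩ := dr5pl_flip
      have hcases : ((e₀ ⟨y, hyT⟩ : ↥({p : EuclideanSpace ℝ (Fin 3) | p = !₂[(0 : ℝ), 0, 1] ∨ p = !₂[(0 : ℝ), 0, -1] ∨ ∃ k : Fin 5, ∃ σ : ℝ, (σ = 1 / 2 ∨ σ = -(1 / 2)) ∧ p = !₂[Real.sqrt 3 / 2 * Real.cos (2 * Real.pi * (k : ℝ) / 5), Real.sqrt 3 / 2 * Real.sin (2 * Real.pi * (k : ℝ) / 5), σ]} : Set (EuclideanSpace ℝ (Fin 3)))) : (EuclideanSpace ℝ (Fin 3))) = -((e p : ↥({p : EuclideanSpace ℝ (Fin 3) | p = !₂[(0 : ℝ), 0, 1] ∨ p = !₂[(0 : ℝ), 0, -1] ∨ ∃ k : Fin 5, ∃ σ : ℝ, (σ = 1 / 2 ∨ σ = -(1 / 2)) ∧ p = !₂[Real.sqrt 3 / 2 * Real.cos (2 * Real.pi * (k : ℝ) / 5), Real.sqrt 3 / 2 * Real.sin (2 * Real.pi * (k : ℝ)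 / 5), σ]} : Set (EuclideanSpace ℝ (Fin 3)))) : (EuclideanSpace ℝ (Fin 3))) ∨
          ((e₀ ⟨y, hyT⟩ : ↥({p : EuclideanSpace ℝ (Fin 3) | p = !₂[(0 : ℝ), 0, 1] ∨ p = !₂[(0 : ℝ), 0, -1] ∨ ∃ k : Fin 5, ∃ σ : ℝ, (σ = 1 / 2 ∨ σ = -(1 / 2)) ∧ p = !₂[Real.sqrt 3 / 2 * Real.cos (2 * Real.pi * (k : ℝ) / 5), Real.sqrt 3 / 2 * Real.sin (2 * Real.pi * (k : ℝ) / 5), σ]} : Set (EuclideanSpace ℝ (Fin 3)))) : (EuclideanSpace ℝ (Fin 3))) = ((e p : ↥({p : EuclideanSpace ℝ (Fin 3) | p = !₂[(0 : ℝ), 0, 1] ∨ p = !₂[(0 : ℝ), 0, -1] ∨ ∃ k : Fin 5, ∃ σ : ℝ, (σ = 1 / 2 ∨ σ = -(1 / 2)) ∧ p = !₂[Real.sqrt 3 / 2 * Real.cos (2 * Real.pi * (k : ℝ) / 5), Real.sqrt 3 / 2 * Real.sin (2 * Real.pi * (k : ℝ) / 5), σ]} : Set (EuclideanSpace ℝ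 (Fin 3)))) : (EuclideanSpace ℝ (Fin 3))) := by
        rcases hpole with h0 | h0 <;> rcases hp with h1 | h1 <;> rw [h0, h1]
        · exact Or.inr rfl
        · exact Or.inl dr5pl_neg_south.symm
        · exact Or.inl dr5pl_neg_north.symm
        · exact Or.inr rfl
      rcases hcases with hc | hc
      · exact ⟨A₀, e₀, he₀, hyT, hc⟩
      · obtain ⟨FD, hFD⟩ : ∃ FD : ↥({p : EuclideanSpace ℝ (Fin 3) | p = !₂[(0 : ℝ), 0, 1] ∨ p = !₂[(0 : ℝ), 0, -1] ∨ ∃ k : Fin 5, ∃ σ : ℝ, (σ = 1 / 2 ∨ σ = -(1 / 2)) ∧ p = !₂[Real.sqrt 3 / 2 * Real.cos (2 * Real.pi * (k : ℝ) / 5), Real.sqrt 3 / 2 * Real.sin (2 * Real.pi * (k : ℝ) / 5), σ]} : Set (EuclideanSpace ℝ (Fin 3))) ≃ ↥({p : EuclideanSpace ℝ (Fin 3) | p = !₂[(0 : ℝ), 0, 1] ∨ p = !₂[(0 : ℝ), 0, -1] ∨ ∃ k : Fin 5, ∃ σ : ℝ, (σ = 1 / 2 ∨ σ = -(1 / 2))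 ∧ p = !₂[Real.sqrt 3 / 2 * Real.cos (2 * Real.pi * (k : ℝ) / 5), Real.sqrt 3 / 2 * Real.sin (2 * Real.pi * (k : ℝ) / 5), σ]} : Set (EuclideanSpace ℝ (Fin 3))), ∀ q : ↥({p : EuclideanSpace ℝ (Fin 3) | p = !₂[(0 : ℝ), 0, 1] ∨ p = !₂[(0 : ℝ), 0, -1] ∨ ∃ k : Fin 5, ∃ σ : ℝ, (σ = 1 / 2 ∨ σ = -(1 / 2)) ∧ p = !₂[Real.sqrt 3 / 2 * Real.cos (2 * Real.pi * (k : ℝ) / 5), Real.sqrt 3 / 2 * Real.sin (2 * Real.pi * (k : ℝ) / 5), σ]} : Set (EuclideanSpace ℝ (Fin 3))), ((FD q : ↥({p : EuclideanSpace ℝ (Fin 3) | p = !₂[(0 : ℝ), 0, 1] ∨ p = !₂[(0 : ℝ), 0, -1] ∨ ∃ k : Fin 5, ∃ σ : ℝ, (σ = 1 / 2 ∨ σ = -(1 / 2)) ∧ p = !₂[Real.sqrt 3 / 2 * Real.cos (2 * Real.pi * (k : ℝ) / 5), Real.sqrt 3 / 2 * Real.sin (2 * Real.pi * (k : ℝ)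 / 5), σ]} : Set (EuclideanSpace ℝ (Fin 3)))) : (EuclideanSpace ℝ (Fin 3))) = F (q : (EuclideanSpace ℝ (Fin 3))) :=
          ⟨⟨fun q => ⟨F q, dr5pl_flip_deca F hF q q.2⟩, fun q => ⟨F q, dr5pl_flip_deca F hF q q.2⟩,
            fun q => Subtype.ext (hFF q), fun q => Subtype.ext (hFF q)⟩, fun q => rfl⟩
        refine ⟨A₀.comp F.toLinearIsometry, e₀.trans FD, ?_, hyT, ?_⟩
        · intro t
          have h1 : (A₀.comp F.toLinearIsometry) (((e₀.trans FD) t : ↥({p : EuclideanSpace ℝ (Fin 3) | p = !₂[(0 : ℝ), 0, 1] ∨ p = !₂[(0 : ℝ), 0, -1] ∨ ∃ k : Fin 5, ∃ σ : ℝ, (σ = 1 / 2 ∨ σ = -(1 / 2)) ∧ p = !₂[Real.sqrt 3 / 2 * Real.cos (2 * Real.pi * (k : ℝ) / 5), Real.sqrt 3 / 2 * Real.sin (2 * Real.pi * (k : ℝ) / 5), σ]} : Set (EuclideanSpace ℝ (Fin 3)))) : (EuclideanSpace ℝ (Fin 3))) =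
              A₀ ((e₀ t : ↥({p : EuclideanSpace ℝ (Fin 3) | p = !₂[(0 : ℝ), 0, 1] ∨ p = !₂[(0 : ℝ), 0, -1] ∨ ∃ k : Fin 5, ∃ σ : ℝ, (σ = 1 / 2 ∨ σ = -(1 / 2)) ∧ p = !₂[Real.sqrt 3 / 2 * Real.cos (2 * Real.pi * (k : ℝ) / 5), Real.sqrt 3 / 2 * Real.sin (2 * Real.pi * (k : ℝ) / 5), σ]} : Set (EuclideanSpace ℝ (Fin 3)))) : (EuclideanSpace ℝ (Fin 3))) := by
            simp [hFD, hFF]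
          rw [h1]
          exact he₀ t
        · rw [Equiv.trans_apply, hFD, hc]
          exact dr5pl_flip_pole F hF _ hp

end Summit.AtomisticToContinuum.Crystallization.Theorems

end
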